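import Summits.Ventures.LatticeQCDFlow.Scaling.ClockConditionedRenewal

/-!
HONEST FRAMING: exact (Metropolis-corrected) sampling algorithms for lattice gauge theory; figures
of merit are autocorrelation/cost numbers at stated couplings and volumes; no continuum-physics
claim.

# PerAttemptMeanCondition — THE ARITHMETIC OF THE PER-EDGE MEAN CONDITION: FROM THE PER-ATTEMPT VALUES `V_j ≤ Φ + (e−2) + c^X_j + c^Y_j − (Φ+e−2)g_j + (Φ+e−1)ε_j`, THE
# TRUNCATION BOUNDS OF FILE 9 AND ONE RESOLVENT-LEVEL CERTIFICATE, `Σ_{j<n}σʲ(1−σ)V_j ≤ (1−r̃)Φ` FOR EVERY `n` — THE `σⁿ`-TERMS CANCEL (lean-2 GEN-43, ours)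

Venture-side (OURS).  Cell `lqcd-flow` (pub-lqcd), unit `pub-lqcd-lean-2-g43`, 2026-08-31.  Chapter AC, file 16 — the third lemma of the instantiation step (memo MEMO-gen43 §3 (e)),
isolated as a statement about real sequences so that the instantiation only has to produce its inputs.  Per attempt count `j`, file 10 gives the value of an adjacent edge
`V_j ≤ Φ + e − R_{x_j} − R_{y_j} − (Φ+e−2)G_j + (e_j)⁺` with `R = 1 − cost`, `G_j = g_j − (e_j)⁺`, i.e. `V_j ≤ Φ + (e−2) + c^X_j + c^Y_j − (Φ+e−2)g_j + (Φ+e−1)ε_j` (`ε_j = (e_j)⁺`,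
`g_j = x_j(★) + x_j(a) − y_j(a) ∈ [0,1]`); file 9 gives for the truncations `Σ_{j<n}σʲ(1−σ)c_j ≤ C` (costs, `0 ≤ 1−θ ≤ 1`) and `Σ_{j<n}σʲ(1−σ)g_j ≥ G − σⁿ` (`g ≤ 1`); and with
`Σ_{j<n}σʲ(1−σ) = 1 − σⁿ` the terms in `σⁿ(Φ+e−2)` CANCEL.  So the mean condition of files 4–6 for every `n` follows from the single inequality
`(e−2) + C^X + C^Y + (Φ+e−1)·D_n + r̃Φ ≤ (Φ+e−2)·G` (`D_n = Σ_{j<n}σʲ(1−σ)ε_j`), which the instantiation discharges from Conjecture W′ (file 3), the discounted weak Σ (file 13) and the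
refresh income (`e − 2 = −2σpE_{μ0}[Wθ] − 2(1−σ)(1−θ_z)`, W22).

* **`perAttempt_mean_of_certificate`**: the implication above, with the rates `r_j := 1 − V_j/Φ`.

Literature grade (cell rule): OWN, elementary; nothing cited; no new bib keys.
-/

open Finset

namespace Summit.Ventures.LatticeQCDFlow.Scaling

section MeanCondition

/-- **THE PER-EDGE MEAN CONDITION FROM ONE RESOLVENT-LEVEL CERTIFICATE** (see the module docstring). [ours] -/
theorem perAttempt_mean_of_certificate {σ Φ e CX CY G rt : ℝ} {V cx cy g ε : ℕ → ℝ}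
    (hΦ : 0 < Φ) (hL : 0 ≤ Φ + e - 2)
    (hV : ∀ j, V j ≤ Φ + (e - 2) + cx j + cy j - (Φ + e - 2) * g j + (Φ + e - 1) * ε j)
    (hcx : ∀ n, ∑ j ∈ range n, σ ^ j * (1 - σ) * cx j ≤ CX) (hcy : ∀ n, ∑ j ∈ range n, σ ^ j * (1 - σ) * cy j ≤ CY)
    (hg : ∀ n, G - σ ^ n ≤ ∑ j ∈ range n, σ ^ j * (1 - σ) * g j) (hσ0 : 0 ≤ σ) (hσ1 : σ ≤ 1)
    (hcert : ∀ n, (e - 2) + CX + CY + (Φ + e - 1) * ∑ j ∈ range n, σ ^ j * (1 - σ) * ε j + rt * Φ ≤ (Φ + e - 2) * G) (n : ℕ) :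
    ∑ j ∈ range n, σ ^ j * (1 - σ) * (1 - (1 - V j / Φ)) ≤ 1 - rt := by
  have hw : ∀ j, 0 ≤ σ ^ j * (1 - σ) := fun j => mul_nonneg (pow_nonneg hσ0 j) (by linarith)
  -- the weights sum to `1 − σⁿ`
  have hsumw : ∑ j ∈ range n, σ ^ j * (1 - σ) = 1 - σ ^ n := renewal_weights_sum σ n
  -- sum the per-attempt bounds
  have hsum : ∑ j ∈ range n, σ ^ j * (1 - σ) * V j
      ≤ (1 - σ ^ n) * (Φ + (e - 2)) + CX + CY - (Φ + e - 2) * (G - σ ^ n) + (Φ + e - 1) * ∑ j ∈ range n, σ ^ j * (1 - σ) * ε j := by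
    calc ∑ j ∈ range n, σ ^ j * (1 - σ) * V j
        ≤ ∑ j ∈ range n, σ ^ j * (1 - σ) * (Φ + (e - 2) + cx j + cy j - (Φ + e - 2) * g j + (Φ + e - 1) * ε j) :=
          sum_le_sum fun j _ => mul_le_mul_of_nonneg_left (hV j) (hw j)
      _ = (∑ j ∈ range n, σ ^ j * (1 - σ)) * (Φ + (e - 2)) + ∑ j ∈ range n, σ ^ j * (1 - σ) * cx j + ∑ j ∈ range n, σ ^ j * (1 - σ) * cy j
            - (Φ + e - 2) * ∑ j ∈ range n, σ ^ j * (1 - σ) * g j + (Φ + e - 1) * ∑ j ∈ range n, σ ^ j * (1 - σ) * ε j := by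
          rw [sum_mul, mul_sum, mul_sum, ← sum_add_distrib, ← sum_add_distrib, ← sum_sub_distrib, ← sum_add_distrib]
          exact sum_congr rfl fun j _ => by ring
      _ ≤ (1 - σ ^ n) * (Φ + (e - 2)) + CX + CY - (Φ + e - 2) * (G - σ ^ n) + (Φ + e - 1) * ∑ j ∈ range n, σ ^ j * (1 - σ) * ε j := by
          rw [hsumw]
          have h1 := hcx n
          have h2 := hcy n
          have h3 := mul_le_mul_of_nonneg_left (hg n) hL
          linarith
  -- the `σⁿ`-terms cancel; the certificate closes
  have hkey : ∑ j ∈ range n, σ ^ j * (1 - σ) * V j ≤ (1 - rt) * Φ := by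
    have := hcert n
    nlinarith [hsum, this]
  -- rewrite the rates
  have e1 : ∑ j ∈ range n, σ ^ j * (1 - σ) * (1 - (1 - V j / Φ)) = (∑ j ∈ range n, σ ^ j * (1 - σ) * V j) / Φ := by
    rw [sum_div]; exact sum_congr rfl fun j _ => by field_simp; ring
  rw [e1, div_le_iff₀ hΦ]
  linarith

end MeanCondition

end Summit.Ventures.LatticeQCDFlow.Scaling
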